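import Summits.CriticalPhenomena.PercolationContinuityZ3.Theorems.PercNearOneGluingNoHeavyLowerTailGZWheatstonePlus
import Summits.CriticalPhenomena.PercolationContinuityZ3.Theorems.PercNearOneGluingNoHeavyLowerTailGZSeriesHub

/-!
# `NoHeavyLowerTail` (stmt-CriticalPhenomena-4575) — support file: **THEOREM W⁺, fan slot** (cell level)

Support file (`--supports stmt-CriticalPhenomena-4575`; closes nothing; no definitions, no named facts, no sorries),
prover `prim-ineq-prove-2` gen 16, memo `run/shared/lean/prim/prim-ineq-prove-2/THEOREM-WPLUS.md` (§2, fan slot; §9 referee).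
Companion of `GZWheatstonePlus.wplus_bridge_cov_le`: the Wheatstone skeleton with bare edges `a–v (a₂), u–b (b₁), v–b (b₂), u–v (ρ)`
whose FAN slot `a–u` carries an arbitrary two-terminal gadget `P` (terminals `a, u`; internal hub edges to `c` of any weights), given through
`θ_P ≥ w_P > 0` and its mark-pattern law `(τ, α, β, ν)` = P(both sides marked / only the a-side / only the u-side / none), with L-log (`hL`)
and Harris (`hH`).  With `S = a₂(b₂ + (1−b₂)ρb₁)`, `C = b₁((1−a₂) + a₂(1−ρ)(1−b₂)) + (1−b₁)b₂ρ(1−a₂)` (pivotality of the slot),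
`P_u = a₂(ρ + (1−ρ)b₁b₂)` (a ~ u off the slot), `Q_u = b₁ + (1−b₁)ρb₂` (b ~ u off the slot), `T_u = a₂(b₂(ρ+b₁−ρb₁) + (1−b₂)ρb₁)` (a ~ b ~ u off the
slot), the composite `W[P]` has `P(a~c) = τ + α + βP_u`, `P(b~c) = τ(S+C) + αS + βQ_u`, `P(a~c ∧ b~c) = τS + αS + βT_u + Cτ`, `θ = S + Cθ_P`,
`w = m + C w_P`, `m = νS + β(S − T_u)` (memo §1; referee-confirmed by independent enumeration).
**`wplus_fan_cov_le`: `P(a~c ∧ b~c) − P(a~c)P(b~c) ≤ w log(θ/w)`.**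
Proof as for the bridge slot: two-class log-sum + `hL`; Marshall–Olkin coordinates of the pattern (marks `X ∨ Z₁` at `a`, `X ∨ Z₂` at `u`); the idiosyncratic
component is `K' = {a–v, u–b, v–b, u–v}` with independent hubs at `a` and `u`, an SP hub network whose bound `kfan_law0_cov_le` is assembled here from
`GZParallel.parallel_cov_sub_mul_log_le` (edge `v–b` ∥ hub path `v–u–b`), `GZSeriesHub.series_cov_sub_mul_log_le` (edge `a–v` in series) and
`GZSeriesHub.hub_cov_sub_mul_log_le` (terminal hub at `a`); the mixture penalty is paid through the correlation inequality `key_fan_le`.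
[this work — memo THEOREM-WPLUS.md]
-/

namespace Summit.CriticalPhenomena.PercolationContinuityZ3.Theorems

namespace GZWheatstonePlusFan

set_option maxHeartbeats 1600000 in
/-- L-log for the fan-slot remainder `K' = {a–v (a₂), u–b (b₁), v–b (b₂), u–v (ρ)}` with independent hubs `γ₁` at the terminal `a` and `γ₂` at `u`
(cell level): `Cov₀ ≤ w₀ log(S/w₀)` with `w₀ = (1−γ₁)((S−T_u) + (1−γ₂)T_u)`, `P₀(a~c) = γ₁ + (1−γ₁)γ₂P_u`,
`P₀(b~c) = (S−T_u)γ₁ + T_u(1−(1−γ₁)(1−γ₂)) + (Q_u−T_u)γ₂`, `P₀(a~c ∧ b~c) = (S−T_u)γ₁ + T_u(1−(1−γ₁)(1−γ₂)) + (Q_u−T_u)γ₁γ₂`.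
THEOREM SP for this network, assembled from the parallel, series and hub steps. -/
theorem kfan_law0_cov_le {a₂ b₁ b₂ ρ γ₁ γ₂ : ℝ}
    (ha₂ : 0 < a₂) (ha₂1 : a₂ < 1) (hb₁ : 0 < b₁) (hb₁1 : b₁ < 1) (hb₂ : 0 < b₂) (hb₂1 : b₂ < 1)
    (hρ : 0 < ρ) (hρ1 : ρ < 1) (hγ₁ : 0 ≤ γ₁) (hγ₁1 : γ₁ < 1) (hγ₂ : 0 ≤ γ₂) (hγ₂1 : γ₂ < 1)
    {S Pu Qu Tu w₀ PA0 PB0 PAB0 : ℝ}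
    (hS : S = a₂ * (b₂ + (1 - b₂) * ρ * b₁)) (hPu : Pu = a₂ * (ρ + (1 - ρ) * b₁ * b₂)) (hQu : Qu = b₁ + (1 - b₁) * ρ * b₂)
    (hTu : Tu = a₂ * (b₂ * (ρ + b₁ - ρ * b₁) + (1 - b₂) * ρ * b₁))
    (hw₀ : w₀ = (1 - γ₁) * ((S - Tu) + (1 - γ₂) * Tu)) (hPA0 : PA0 = γ₁ + (1 - γ₁) * γ₂ * Pu)
    (hPB0 : PB0 = (S - Tu) * γ₁ + Tu * (1 - (1 - γ₁) * (1 - γ₂)) + (Qu - Tu) * γ₂)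
    (hPAB0 : PAB0 = (S - Tu) * γ₁ + Tu * (1 - (1 - γ₁) * (1 - γ₂)) + (Qu - Tu) * (γ₁ * γ₂)) :
    PAB0 - PA0 * PB0 ≤ w₀ * Real.log (S / w₀) := by
  obtain ⟨h1a₂, h1b₁, h1b₂, h1ρ, h1γ₁, h1γ₂⟩ : 0 < 1 - a₂ ∧ 0 < 1 - b₁ ∧ 0 < 1 - b₂ ∧ 0 < 1 - ρ ∧ 0 < 1 - γ₁ ∧ 0 < 1 - γ₂ :=
    ⟨by linarith, by linarith, by linarith, by linarith, by linarith, by linarith⟩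
  -- (P) the hub path v–u–b (first terminal v), hub γ₂ at u
  set tp := ρ * b₁ * γ₂ with htp
  set wp := ρ * b₁ * (1 - γ₂) with hwp
  set xp := (1 - ρ) * b₁ * γ₂ with hxp
  set yp := ρ * (1 - b₁) * γ₂ with hyp
  set np := (1 - ρ) * (1 - b₁) + (1 - γ₂) * (ρ * (1 - b₁) + (1 - ρ) * b₁) with hnp
  have htp0 : 0 ≤ tp := by positivity
  have hwp0 : 0 < wp := by positivity
  have hxp0 : 0 ≤ xp := by positivity
  have hyp0 : 0 ≤ yp := by positivity
  have hnp0 : 0 < np := by positivity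
  have hsp : tp + wp + 0 + xp + yp + np = 1 := by rw [htp, hwp, hxp, hyp, hnp]; ring
  have H3p : yp * (wp + xp) ≤ np * (tp + 0) := by
    have e : np * (tp + 0) - yp * (wp + xp) = ρ * b₁ * γ₂ * ((1 - ρ) * (1 - γ₂)) := by rw [hnp, htp, hyp, hwp, hxp]; ring
    have : 0 ≤ ρ * b₁ * γ₂ * ((1 - ρ) * (1 - γ₂)) := by positivity
    linarith
  have H4p : xp * (wp + yp) ≤ np * (tp + 0) := by
    have e : np * (tp + 0) - xp * (wp + yp) = ρ * b₁ * γ₂ * ((1 - b₁) * (1 - γ₂)) := by rw [hnp, htp, hyp, hwp, hxp]; ring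
    have : 0 ≤ ρ * b₁ * γ₂ * ((1 - b₁) * (1 - γ₂)) := by positivity
    linarith
  -- (E) the bare edge v–b: cells (0, b₂, 0, 0, 0, 1 − b₂)
  have hse : (0:ℝ) + b₂ + 0 + 0 + 0 + (1 - b₂) = 1 := by ring
  have H3e : (0:ℝ) * (b₂ + 0) ≤ (1 - b₂) * (0 + 0) := by simp
  have H4e : (0:ℝ) * (b₂ + 0) ≤ (1 - b₂) * (0 + 0) := by simp
  -- (PAR) edge ∥ hub path, terminals (v, b)
  have hpar := GZParallel.parallel_cov_sub_mul_log_le htp0 hwp0 le_rfl hxp0 hyp0 hnp0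
    le_rfl hb₂ le_rfl le_rfl le_rfl h1b₂ hsp hse H3p H4p H3e H4e
  -- the path satisfies the bound by γ ≤ −log(1−γ); the edge trivially
  have hpath : (wp + np) * (tp + 0) - xp * yp - wp * Real.log ((tp + wp) / wp) ≤ 0 := by
    have e1 : (wp + np) * (tp + 0) - xp * yp = ρ * b₁ * (1 - γ₂) * γ₂ := by rw [hwp, hnp, htp, hxp, hyp]; ring
    have e2 : (tp + wp) / wp = (1 - γ₂)⁻¹ := by
      rw [htp, hwp]
      have hne : ρ * b₁ ≠ 0 := (mul_pos hρ hb₁).ne'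
      field_simp
      ring
    rw [e1, e2, Real.log_inv]
    have hl : γ₂ ≤ -Real.log (1 - γ₂) := by have := Real.log_le_sub_one_of_pos h1γ₂; linarith
    have hc : 0 ≤ ρ * b₁ * (1 - γ₂) := by positivity
    have h := mul_le_mul_of_nonneg_left hl hc
    have e3 : wp * -Real.log (1 - γ₂) = ρ * b₁ * (1 - γ₂) * -Real.log (1 - γ₂) := by rw [hwp]
    linarith
  have hedge : ((b₂ + (1 - b₂)) * (0 + 0) - 0 * 0) - b₂ * Real.log ((0 + b₂) / b₂) = 0 := by
    have : (0 + b₂) / b₂ = 1 := by rw [zero_add, div_self hb₂.ne']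
    rw [this, Real.log_one]; ring
  -- cells of the (v,b) parallel composite
  obtain ⟨t₂, ht₂⟩ : ∃ x : ℝ, x = tp + b₂ * (xp + yp) := ⟨_, rfl⟩
  obtain ⟨w₂, hw₂⟩ : ∃ x : ℝ, x = wp + np * b₂ := ⟨_, rfl⟩
  obtain ⟨x₂, hx₂⟩ : ∃ x : ℝ, x = xp * (1 - b₂) := ⟨_, rfl⟩
  obtain ⟨y₂, hy₂⟩ : ∃ x : ℝ, x = yp * (1 - b₂) := ⟨_, rfl⟩
  obtain ⟨n₂, hn₂⟩ : ∃ x : ℝ, x = np * (1 - b₂) := ⟨_, rfl⟩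
  have ht₂0 : 0 ≤ t₂ := by rw [ht₂]; positivity
  have hw₂0 : 0 < w₂ := by rw [hw₂]; positivity
  have hx₂0 : 0 ≤ x₂ := by rw [hx₂]; positivity
  have hy₂0 : 0 ≤ y₂ := by rw [hy₂]; positivity
  have hn₂0 : 0 ≤ n₂ := by rw [hn₂]; positivity
  have hs₂ : t₂ + w₂ + 0 + x₂ + y₂ + n₂ = 1 := by
    rw [ht₂, hw₂, hx₂, hy₂, hn₂]; linear_combination (1 : ℝ) * hsp
  -- identify the parallel composite's defect with hpar's left-hand side
  have ePar : ((w₂ + n₂) * (t₂ + 0) - x₂ * y₂) - w₂ * Real.log ((t₂ + w₂) / w₂) =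
      ((wp + np) * (b₂ + (1 - b₂)) -
          ((np + xp) * ((1 - b₂) + 0) + ((wp + np) * (b₂ + (1 - b₂)) - np * (1 - b₂))) *
            ((np + yp) * ((1 - b₂) + 0) + ((wp + np) * (b₂ + (1 - b₂)) - np * (1 - b₂)))) -
        ((wp + np) * (b₂ + (1 - b₂)) - np * (1 - b₂)) *
          Real.log (((tp + wp) + (0 + b₂) - (tp + wp) * (0 + b₂)) / ((wp + np) * (b₂ + (1 - b₂)) - np * (1 - b₂))) := by
    have e1 : (w₂ + n₂) * (t₂ + 0) - x₂ * y₂ = (wp + np) * (b₂ + (1 - b₂)) -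
          ((np + xp) * ((1 - b₂) + 0) + ((wp + np) * (b₂ + (1 - b₂)) - np * (1 - b₂))) *
            ((np + yp) * ((1 - b₂) + 0) + ((wp + np) * (b₂ + (1 - b₂)) - np * (1 - b₂))) := by
      rw [ht₂, hw₂, hx₂, hy₂, hn₂]
      have hnp' : np = 1 - tp - wp - xp - yp := by linarith
      rw [hnp']; ring
    have e2 : w₂ = (wp + np) * (b₂ + (1 - b₂)) - np * (1 - b₂) := by rw [hw₂]; ring
    have e3 : t₂ + w₂ = (tp + wp) + (0 + b₂) - (tp + wp) * (0 + b₂) := by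
      rw [ht₂, hw₂]
      have hnp' : np = 1 - tp - wp - xp - yp := by linarith
      rw [hnp']; ring
    rw [e1, e3, ← e2]
  have hparDef : ((w₂ + n₂) * (t₂ + 0) - x₂ * y₂) - w₂ * Real.log ((t₂ + w₂) / w₂) ≤ 0 := by
    rw [ePar]
    have hz1 : 0 ≤ b₂ + (1 - b₂) := by linarith
    have hz2 : 0 ≤ wp + np := by linarith
    have h1 := mul_nonpos_of_nonneg_of_nonpos hz1 hpath
    have h2 : (wp + np) * (((b₂ + (1 - b₂)) * (0 + 0) - 0 * 0) - b₂ * Real.log ((0 + b₂) / b₂)) = 0 := by rw [hedge]; ring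
    linarith [hpar, h1, h2]
  -- (SER) the bare edge a–v (a₂) in series with the (v,b) composite
  have hsa : (0:ℝ) + a₂ + 0 + 0 + 0 + (1 - a₂) = 1 := by ring
  have hser := GZSeriesHub.series_cov_sub_mul_log_le le_rfl ha₂ le_rfl le_rfl le_rfl h1a₂.le
    ht₂0 hw₂0 le_rfl hx₂0 hy₂0 hn₂0 hsa hs₂
  have hedgeA : ((a₂ + (1 - a₂)) * (0 + 0) - 0 * 0) - a₂ * Real.log ((0 + a₂) / a₂) = 0 := by
    have : (0 + a₂) / a₂ = 1 := by rw [zero_add, div_self ha₂.ne']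
    rw [this, Real.log_one]; ring
  -- cells of the series composite (a,b): t = a₂t₂, w = a₂w₂, x = (1−a₂)(t₂+x₂) + a₂x₂, y = a₂y₂, n = (1−a₂)(n₂+y₂+w₂) + a₂n₂, q = 0
  obtain ⟨ts, hts⟩ : ∃ x : ℝ, x = a₂ * t₂ := ⟨_, rfl⟩
  obtain ⟨ws, hws⟩ : ∃ x : ℝ, x = a₂ * w₂ := ⟨_, rfl⟩
  obtain ⟨xs, hxs⟩ : ∃ x : ℝ, x = (1 - a₂) * (t₂ + x₂) + a₂ * x₂ := ⟨_, rfl⟩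
  obtain ⟨ys, hys⟩ : ∃ x : ℝ, x = a₂ * y₂ := ⟨_, rfl⟩
  obtain ⟨ns, hns⟩ : ∃ x : ℝ, x = (1 - a₂) * (n₂ + y₂ + w₂) + a₂ * n₂ := ⟨_, rfl⟩
  have hts0 : 0 ≤ ts := by rw [hts]; positivity
  have hws0 : 0 < ws := by rw [hws]; positivity
  have hxs0 : 0 ≤ xs := by rw [hxs]; positivity
  have hys0 : 0 ≤ ys := by rw [hys]; positivity
  have hns0 : 0 ≤ ns := by rw [hns]; positivity
  have hss : ts + ws + 0 + xs + ys + ns = 1 := by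
    rw [hts, hws, hxs, hys, hns]; linear_combination (1 : ℝ) * hs₂
  have eSer : ((ws + ns) * (ts + 0) - xs * ys) - ws * Real.log ((ts + ws) / ws) =
      ((1 - a₂ + 0) * (n₂ + y₂) + a₂ * n₂ + (1 - a₂) * w₂ + a₂ * w₂ -
          ((1 - a₂ + 0) + a₂ * (w₂ + n₂ + x₂)) * ((n₂ + y₂) + w₂ * (a₂ + (1 - a₂) + 0))) -
        a₂ * w₂ * Real.log ((0 + a₂) * (t₂ + w₂) / (a₂ * w₂)) := by
    have e1 : (ws + ns) * (ts + 0) - xs * ys = (1 - a₂ + 0) * (n₂ + y₂) + a₂ * n₂ + (1 - a₂) * w₂ + a₂ * w₂ -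
          ((1 - a₂ + 0) + a₂ * (w₂ + n₂ + x₂)) * ((n₂ + y₂) + w₂ * (a₂ + (1 - a₂) + 0)) := by
      rw [hts, hws, hxs, hys, hns]
      have hn₂' : n₂ = 1 - t₂ - w₂ - x₂ - y₂ := by linarith
      rw [hn₂']; ring
    have e3 : (ts + ws) / ws = (0 + a₂) * (t₂ + w₂) / (a₂ * w₂) := by
      rw [hts, hws]; ring
    rw [e1, e3, hws]
  have hserDef : ((ws + ns) * (ts + 0) - xs * ys) - ws * Real.log ((ts + ws) / ws) ≤ 0 := by
    rw [eSer]
    have h1 : w₂ * (((a₂ + (1 - a₂)) * (0 + 0) - 0 * 0) - a₂ * Real.log ((0 + a₂) / a₂)) = 0 := by rw [hedgeA]; ring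
    have h2 := mul_nonpos_of_nonneg_of_nonpos ha₂.le hparDef
    linarith [hser, h1, h2]
  -- (HUB) raise the hub at the terminal a by γ₁
  have hhub := GZSeriesHub.hub_cov_sub_mul_log_le hts0 hws0 le_rfl hxs0 hys0 hns0 hss hγ₁ hγ₁1
  have hfin : (((1 - γ₁) * ws + (1 - γ₁) * ns) * ((ts + γ₁ * ws) + (0 + γ₁ * xs)) - ((1 - γ₁) * xs) * (ys + γ₁ * ns)) -
      (1 - γ₁) * ws * Real.log ((ts + γ₁ * ws + (1 - γ₁) * ws) / ((1 - γ₁) * ws)) ≤ 0 := by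
    have h2 := mul_nonpos_of_nonneg_of_nonpos h1γ₁.le hserDef
    linarith [hhub, h2]
  -- identify with the structured cells of Law₀
  have eCov : ((1 - γ₁) * ws + (1 - γ₁) * ns) * ((ts + γ₁ * ws) + (0 + γ₁ * xs)) - ((1 - γ₁) * xs) * (ys + γ₁ * ns) =
      PAB0 - PA0 * PB0 := by
    rw [hPAB0, hPA0, hPB0, hts, hws, hxs, hys, hns, ht₂, hw₂, hx₂, hy₂, hn₂, hS, hPu, hQu, hTu, htp, hwp, hxp, hyp, hnp]; ring
  have eW : (1 - γ₁) * ws = w₀ := by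
    rw [hw₀, hws, hw₂, hS, hTu, hwp, hnp]; ring
  have eT : ts + γ₁ * ws + (1 - γ₁) * ws = S := by
    rw [hts, hws, ht₂, hw₂, hS, htp, hwp, hxp, hyp, hnp]; ring
  rw [eCov, eT, eW] at hfin
  linarith

/-- **KEY (fan slot)**: with independent marks at `a` (prob `1−q₁`) and `u` (prob `1−q₂`) on `K' = {a–v, u–b, v–b, u–v}`, the events
`E_a = {C_a unmarked}` and `E_b = {C_b meets {a,u}, C_b unmarked}` are positively correlated: `P(E_a)P(E_b) ≤ P(E_a ∩ E_b) = w₀ + Cq₁q₂`.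
Explicit certificate (conditional covariance given the marks + Harris on the marks), every summand a product of nonnegative polynomials. -/
theorem key_fan_le {a₂ b₁ b₂ ρ q₁ q₂ : ℝ}
    (ha₂ : 0 ≤ a₂) (ha₂1 : a₂ ≤ 1) (hb₁ : 0 ≤ b₁) (hb₁1 : b₁ ≤ 1) (hb₂ : 0 ≤ b₂) (hb₂1 : b₂ ≤ 1)
    (hρ : 0 ≤ ρ) (hρ1 : ρ ≤ 1) (hq₁ : 0 ≤ q₁) (hq₁1 : q₁ ≤ 1) (hq₂ : 0 ≤ q₂) (hq₂1 : q₂ ≤ 1)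
    {S Pu Qu Tu : ℝ}
    (hS : S = a₂ * (b₂ + (1 - b₂) * ρ * b₁)) (hPu : Pu = a₂ * (ρ + (1 - ρ) * b₁ * b₂)) (hQu : Qu = b₁ + (1 - b₁) * ρ * b₂)
    (hTu : Tu = a₂ * (b₂ * (ρ + b₁ - ρ * b₁) + (1 - b₂) * ρ * b₁)) :
    (q₁ * (q₂ + (1 - q₂) * (1 - Pu))) * (q₁ * q₂ * (Qu + S - Tu) + (1 - q₁) * q₂ * (Qu - Tu) + q₁ * (1 - q₂) * (S - Tu))
      ≤ q₁ * q₂ * (Qu + S - Tu) + q₁ * (1 - q₂) * (S - Tu) := by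
  have h1a₂ : 0 ≤ 1 - a₂ := by linarith
  have h1b₁ : 0 ≤ 1 - b₁ := by linarith
  have h1b₂ : 0 ≤ 1 - b₂ := by linarith
  have h1ρ : 0 ≤ 1 - ρ := by linarith
  have h1q₁ : 0 ≤ 1 - q₁ := by linarith
  have h1q₂ : 0 ≤ 1 - q₂ := by linarith
  have hPu0 : 0 ≤ Pu := by rw [hPu]; positivity
  have hPu1 : 0 ≤ 1 - Pu := by
    rw [hPu]
    have h1 : ρ + (1 - ρ) * b₁ * b₂ ≤ 1 := by nlinarith [mul_le_one₀ hb₁1 hb₂ hb₂1, mul_nonneg h1ρ (mul_nonneg hb₁ hb₂)]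
    have h2 : 0 ≤ ρ + (1 - ρ) * b₁ * b₂ := by positivity
    nlinarith [mul_le_one₀ ha₂1 h2 h1]
  have hQu0 : 0 ≤ Qu := by rw [hQu]; positivity
  have hS0 : 0 ≤ S := by rw [hS]; positivity
  have hSTu : 0 ≤ S - Tu := by
    have e : S - Tu = a₂ * b₂ * (1 - ρ) * (1 - b₁) := by rw [hS, hTu]; ring
    rw [e]; positivity
  -- certificate: KEY = q₁(1−q₂)·(S−T_u)·P_u + q₁(1−q₂)q₂·P_u·Q_u + (1−q₁)q₁·(q₂ + (1−q₂)(1−P_u))·(q₂S + (1−q₂)(S−T_u))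
  have key : q₁ * q₂ * (Qu + S - Tu) + q₁ * (1 - q₂) * (S - Tu)
      - (q₁ * (q₂ + (1 - q₂) * (1 - Pu))) * (q₁ * q₂ * (Qu + S - Tu) + (1 - q₁) * q₂ * (Qu - Tu) + q₁ * (1 - q₂) * (S - Tu))
      = q₁ * (1 - q₂) * ((S - Tu) * Pu) + q₁ * ((1 - q₂) * q₂) * (Pu * Qu)
        + (1 - q₁) * q₁ * ((q₂ + (1 - q₂) * (1 - Pu)) * (q₂ * S + (1 - q₂) * (S - Tu))) := by
    ring
  have hpos : 0 ≤ q₁ * (1 - q₂) * ((S - Tu) * Pu) + q₁ * ((1 - q₂) * q₂) * (Pu * Qu)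
        + (1 - q₁) * q₁ * ((q₂ + (1 - q₂) * (1 - Pu)) * (q₂ * S + (1 - q₂) * (S - Tu))) := by
    positivity
  linarith [key, hpos]

set_option maxHeartbeats 800000 in
/-- **LEMMA K'-MO (fan slot)** (memo §2, fan case): `K' = {a–v, u–b, v–b, u–v}` carrying a Marshall–Olkin correlated mark pair at `(a,u)`
(`ν = q_Xq₁q₂`, `α = q_X(1−q₁)q₂` (only a), `β = q_Xq₁(1−q₂)` (only u), `τ = 1−ν−α−β`) satisfies `Cov(A,B) − C(ντ−αβ) ≤ m log(S/m)`. -/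
theorem kfan_mo {a₂ b₁ b₂ ρ q₁ q₂ qX ν α β τ : ℝ}
    (ha₂ : 0 < a₂) (ha₂1 : a₂ < 1) (hb₁ : 0 < b₁) (hb₁1 : b₁ < 1) (hb₂ : 0 < b₂) (hb₂1 : b₂ < 1)
    (hρ : 0 < ρ) (hρ1 : ρ < 1) (hq₁ : 0 < q₁) (hq₁1 : q₁ ≤ 1) (hq₂ : 0 < q₂) (hq₂1 : q₂ ≤ 1) (hqX : 0 < qX) (hqX1 : qX ≤ 1)
    (hν : ν = qX * q₁ * q₂) (hα : α = qX * (1 - q₁) * q₂) (hβ : β = qX * q₁ * (1 - q₂)) (hτ : τ = 1 - ν - α - β)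
    {S C Pu Qu Tu PA PB PAB m : ℝ}
    (hS : S = a₂ * (b₂ + (1 - b₂) * ρ * b₁))
    (hC : C = b₁ * ((1 - a₂) + a₂ * (1 - ρ) * (1 - b₂)) + (1 - b₁) * b₂ * ρ * (1 - a₂))
    (hPu : Pu = a₂ * (ρ + (1 - ρ) * b₁ * b₂)) (hQu : Qu = b₁ + (1 - b₁) * ρ * b₂)
    (hTu : Tu = a₂ * (b₂ * (ρ + b₁ - ρ * b₁) + (1 - b₂) * ρ * b₁))
    (hPA : PA = τ + α + β * Pu) (hPB : PB = τ * (S + C) + α * S + β * Qu)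
    (hPAB : PAB = τ * S + α * S + β * Tu + C * τ) (hm : m = S - (τ * S + α * S + β * Tu)) :
    PAB - PA * PB - C * (ν * τ - α * β) ≤ m * Real.log (S / m) := by
  obtain ⟨h1a₂, h1b₁, h1b₂, h1ρ⟩ : 0 < 1 - a₂ ∧ 0 < 1 - b₁ ∧ 0 < 1 - b₂ ∧ 0 < 1 - ρ :=
    ⟨by linarith, by linarith, by linarith, by linarith⟩
  have h1q₁ : 0 ≤ 1 - q₁ := by linarith
  have h1q₂ : 0 ≤ 1 - q₂ := by linarith
  have h1qX : 0 ≤ 1 - qX := by linarith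
  have hS0 : 0 < S := by rw [hS]; positivity
  have hC0 : 0 ≤ C := by rw [hC]; positivity
  have hSTu : 0 ≤ S - Tu := by
    have e : S - Tu = a₂ * b₂ * (1 - ρ) * (1 - b₁) := by rw [hS, hTu]; ring
    rw [e]; positivity
  have hTu0 : 0 ≤ Tu := by
    have e : Tu = a₂ * (b₂ * (ρ + b₁ * (1 - ρ)) + (1 - b₂) * ρ * b₁) := by rw [hTu]; ring
    rw [e]; positivity
  -- Law₀: hubs γ₁ = 1 − q₁ at a, γ₂ = 1 − q₂ at u
  obtain ⟨w₀, hw₀⟩ : ∃ x : ℝ, x = (1 - (1 - q₁)) * ((S - Tu) + (1 - (1 - q₂)) * Tu) := ⟨_, rfl⟩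
  obtain ⟨P0A, hP0A⟩ : ∃ x : ℝ, x = (1 - q₁) + (1 - (1 - q₁)) * (1 - q₂) * Pu := ⟨_, rfl⟩
  obtain ⟨P0B, hP0B⟩ : ∃ x : ℝ, x = (S - Tu) * (1 - q₁) + Tu * (1 - (1 - (1 - q₁)) * (1 - (1 - q₂))) + (Qu - Tu) * (1 - q₂) := ⟨_, rfl⟩
  obtain ⟨P0AB, hP0AB⟩ : ∃ x : ℝ, x = (S - Tu) * (1 - q₁) + Tu * (1 - (1 - (1 - q₁)) * (1 - (1 - q₂))) + (Qu - Tu) * ((1 - q₁) * (1 - q₂)) := ⟨_, rfl⟩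
  have h0 := kfan_law0_cov_le ha₂ ha₂1 hb₁ hb₁1 hb₂ hb₂1 hρ hρ1 (γ₁ := 1 - q₁) (γ₂ := 1 - q₂) h1q₁ (by linarith) h1q₂ (by linarith)
    hS hPu hQu hTu hw₀ hP0A hP0B hP0AB
  have hw₀pos : 0 < w₀ := by
    rw [hw₀]
    have e : (1 - (1 - q₁)) * ((S - Tu) + (1 - (1 - q₂)) * Tu) = q₁ * ((S - Tu) + q₂ * Tu) := by ring
    rw [e]
    have h1 : 0 < (S - Tu) + q₂ * Tu := by
      rcases eq_or_lt_of_le hTu0 with h | h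
      · rw [← h]; linarith [hS0]
      · nlinarith [mul_pos hq₂ h]
    positivity
  -- mixture identities
  have em : m = qX * w₀ := by
    rw [hm, hw₀, hτ, hν, hα, hβ]; ring
  obtain ⟨dA, hdA⟩ : ∃ x : ℝ, x = q₁ * (q₂ + (1 - q₂) * (1 - Pu)) := ⟨_, rfl⟩
  obtain ⟨dB, hdB⟩ : ∃ x : ℝ, x = q₁ * q₂ * (Qu + S - Tu) + (1 - q₁) * q₂ * (Qu - Tu) + q₁ * (1 - q₂) * (S - Tu) := ⟨_, rfl⟩
  have ecov : PAB - PA * PB = qX * (P0AB - P0A * P0B) + (1 - qX) * qX * (dA * dB) := by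
    rw [hPAB, hPA, hPB, hP0AB, hP0A, hP0B, hdA, hdB, hC, hτ, hν, hα, hβ, hS, hPu, hQu, hTu]
    ring
  have emu : ν * τ - α * β = (1 - qX) * qX * (q₁ * q₂) := by
    rw [hτ, hν, hα, hβ]; ring
  have hkey : dA * dB ≤ w₀ + C * q₁ * q₂ := by
    have k := key_fan_le ha₂.le ha₂1.le hb₁.le hb₁1.le hb₂.le hb₂1.le hρ.le hρ1.le hq₁.le hq₁1 hq₂.le hq₂1 hS hPu hQu hTu
    have e : q₁ * q₂ * (Qu + S - Tu) + q₁ * (1 - q₂) * (S - Tu) = w₀ + C * q₁ * q₂ := by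
      rw [hw₀, hC, hQu, hS, hTu]; ring
    rw [hdA, hdB, ← e]; exact k
  have hlog : Real.log (S / (qX * w₀)) = Real.log (S / w₀) - Real.log qX := by
    rw [Real.log_div hS0.ne' (mul_pos hqX hw₀pos).ne', Real.log_div hS0.ne' hw₀pos.ne', Real.log_mul hqX.ne' hw₀pos.ne']
    ring
  have hlq : Real.log qX ≤ qX - 1 := Real.log_le_sub_one_of_pos hqX
  rw [ecov, emu, em, hlog]
  have hqq : 0 ≤ (1 - qX) * qX := mul_nonneg h1qX hqX.le
  have t1 : (1 - qX) * qX * (dA * dB) - C * ((1 - qX) * qX * (q₁ * q₂)) ≤ (1 - qX) * qX * w₀ := by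
    have k := mul_le_mul_of_nonneg_left hkey hqq
    have e : (1 - qX) * qX * (w₀ + C * q₁ * q₂) = (1 - qX) * qX * w₀ + C * ((1 - qX) * qX * (q₁ * q₂)) := by ring
    linarith [k, e]
  have t2 : qX * (P0AB - P0A * P0B) ≤ qX * (w₀ * Real.log (S / w₀)) := mul_le_mul_of_nonneg_left h0 hqX.le
  have t3 : (1 - qX) * qX * w₀ ≤ qX * w₀ * (-Real.log qX) := by
    have k := mul_le_mul_of_nonneg_left (show 1 - qX ≤ -Real.log qX by linarith) (mul_nonneg hqX.le hw₀pos.le)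
    have e : qX * w₀ * (1 - qX) = (1 - qX) * qX * w₀ := by ring
    linarith [k, e]
  linarith [t1, t2, t3]

set_option maxHeartbeats 800000 in
/-- **THEOREM W⁺ (cell level, fan slot)** — the logarithmic covariance bound
`P(a~c ∧ b~c) − P(a~c)P(b~c) ≤ P(ab|c)·log(P(a ~ b off c)/P(ab|c))` for the Wheatstone bridge whose fan slot `a–u` carries an arbitrary two-terminal
gadget `P` with connection data `θ_P ≥ w_P > 0` and mark-pattern law `(τ, α, β, ν)` (both / only the a-side / only the u-side / none; `τ ≥ 0` follows
from `hH`) satisfying L-log (`hL`) and Harris (`hH`); cells of the composite as in the module docstring.  [this work — memo THEOREM-WPLUS.md] -/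
theorem wplus_fan_cov_le {a₂ b₁ b₂ ρ τ α β ν θP wP : ℝ}
    (ha₂ : 0 < a₂) (ha₂1 : a₂ < 1) (hb₁ : 0 < b₁) (hb₁1 : b₁ < 1) (hb₂ : 0 < b₂) (hb₂1 : b₂ < 1) (hρ : 0 < ρ) (hρ1 : ρ < 1)
    (hα : 0 ≤ α) (hβ : 0 ≤ β) (hν : 0 < ν) (hsum : τ + α + β + ν = 1)
    (hH : α * β ≤ ν * τ) (hwP : 0 < wP) (hθP : wP ≤ θP)
    (hL : ν * τ - α * β ≤ wP * Real.log (θP / wP))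
    {S C Pu Qu Tu PA PB PAB m θ w : ℝ}
    (hS : S = a₂ * (b₂ + (1 - b₂) * ρ * b₁))
    (hC : C = b₁ * ((1 - a₂) + a₂ * (1 - ρ) * (1 - b₂)) + (1 - b₁) * b₂ * ρ * (1 - a₂))
    (hPu : Pu = a₂ * (ρ + (1 - ρ) * b₁ * b₂)) (hQu : Qu = b₁ + (1 - b₁) * ρ * b₂)
    (hTu : Tu = a₂ * (b₂ * (ρ + b₁ - ρ * b₁) + (1 - b₂) * ρ * b₁))
    (hPA : PA = τ + α + β * Pu) (hPB : PB = τ * (S + C) + α * S + β * Qu)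
    (hPAB : PAB = τ * S + α * S + β * Tu + C * τ) (hm : m = S - (τ * S + α * S + β * Tu))
    (hθ : θ = S + C * θP) (hw : w = m + C * wP) :
    PAB - PA * PB ≤ w * Real.log (θ / w) := by
  obtain ⟨h1a₂, h1b₁, h1b₂, h1ρ⟩ : 0 < 1 - a₂ ∧ 0 < 1 - b₁ ∧ 0 < 1 - b₂ ∧ 0 < 1 - ρ :=
    ⟨by linarith, by linarith, by linarith, by linarith⟩
  have hS0 : 0 < S := by rw [hS]; positivity
  have hC0 : 0 < C := by rw [hC]; positivity
  have hθP0 : 0 < θP := lt_of_lt_of_le hwP hθP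
  have hSTu : 0 ≤ S - Tu := by
    have e : S - Tu = a₂ * b₂ * (1 - ρ) * (1 - b₁) := by rw [hS, hTu]; ring
    rw [e]; positivity
  -- Marshall–Olkin coordinates
  have hνα : 0 < ν + α := by linarith
  have hνβ : 0 < ν + β := by linarith
  obtain ⟨q₁, hq₁⟩ : ∃ x : ℝ, x = ν / (ν + α) := ⟨_, rfl⟩
  obtain ⟨q₂, hq₂⟩ : ∃ x : ℝ, x = ν / (ν + β) := ⟨_, rfl⟩
  obtain ⟨qX, hqX⟩ : ∃ x : ℝ, x = (ν + α) * (ν + β) / ν := ⟨_, rfl⟩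
  have hq₁0 : 0 < q₁ := by rw [hq₁]; positivity
  have hq₂0 : 0 < q₂ := by rw [hq₂]; positivity
  have hqX0 : 0 < qX := by rw [hqX]; positivity
  have hq₁1 : q₁ ≤ 1 := by rw [hq₁, div_le_one hνα]; linarith
  have hq₂1 : q₂ ≤ 1 := by rw [hq₂, div_le_one hνβ]; linarith
  have hqX1 : qX ≤ 1 := by
    rw [hqX, div_le_one hν]
    have h1 : (ν + α) * (ν + β) = ν * (ν + α + β) + α * β := by ring
    have h3 : ν * (ν + α + β) + ν * τ = ν * (τ + α + β + ν) := by ring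
    rw [hsum, mul_one] at h3
    rw [h1]; linarith [hH, h3]
  have eν : ν = qX * q₁ * q₂ := by
    rw [hqX, hq₁, hq₂]; field_simp
  have eα : α = qX * (1 - q₁) * q₂ := by
    rw [hqX, hq₁, hq₂]; field_simp; ring
  have eβ : β = qX * q₁ * (1 - q₂) := by
    rw [hqX, hq₁, hq₂]; field_simp; ring
  have eτ : τ = 1 - ν - α - β := by linarith
  have hc := kfan_mo ha₂ ha₂1 hb₁ hb₁1 hb₂ hb₂1 hρ hρ1 hq₁0 hq₁1 hq₂0 hq₂1 hqX0 hqX1 eν eα eβ eτ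
    hS hC hPu hQu hTu hPA hPB hPAB hm
  have hm0 : 0 < m := by
    have e : m = ν * S + β * (S - Tu) := by rw [hm, eτ]; ring
    rw [e]
    have h1 : 0 < ν * S := mul_pos hν hS0
    have h2 : 0 ≤ β * (S - Tu) := mul_nonneg hβ hSTu
    linarith
  have hls := GZWheatstonePlus.logsum2 (m₁ := m) (m₂ := C * wP) (P₁ := S) (P₂ := C * θP) hm0 (by positivity) hS0 (by positivity)
  have e2 : C * θP / (C * wP) = θP / wP := by
    rw [mul_div_mul_left _ _ hC0.ne']
  rw [e2] at hls
  have hcred : C * (ν * τ - α * β) ≤ C * wP * Real.log (θP / wP) := by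
    have := mul_le_mul_of_nonneg_left hL hC0.le
    linarith
  rw [hθ, hw]
  linarith [hc, hls, hcred]

end GZWheatstonePlusFan

end Summit.CriticalPhenomena.PercolationContinuityZ3.Theorems
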